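import Literature.Probability.Distributions.GaussianShiftHiding
import Literature.Probability.Distributions.PseudoGaussianSamplerTV
import Literature.Probability.Distributions.IndepProductLawMeasure
import Literature.Probability.Distributions.IndepProductLawDistance
import HarnessLib

/-!
# The rounded Gaussian on `ℤⁿ` is a product of rounded one-dimensional Gaussians; the sampler vector is close to it

Topic `Probability/Distributions`, bridge between `GaussianShiftHiding.lean` (`roundedGaussian n σ`:
the law of `round(σ g)`, `g ∼ N(0, Iₙ)` the standard Gaussian of `EuclideanSpace ℝ (Fin n)`, the
perturbation law of the first component of Peikert's `GapSVP → LWE` reduction as analysed in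
`Cryptography/PeikertPerturbation.lean`, pqc.S20), `PseudoGaussianSamplerTV.lean` (`gaussBoxPMF b`:
the law of `round(2ᵇ x)`, `x ∼ 𝒩(0, ½)`, and `PGParams.lawPMF`, the exact law of the coin-driven
sampler, with `Δ(ℓ', ℓ_b) ≤ (F - 1) + 2e^{-(R - h/2)²}`) and the product laws `indepLaw`
(`IndepProductLaw*.lean`). Everything here is PROVED (theorems only).

* `roundedGaussianMeasure_eq_pi_map`, **`roundedGaussianMeasure_eq_pi`** — the coordinates of
  `round(σ g)` are INDEPENDENT with the law of `round(σ t)`, `t ∼ 𝒩(0, 1)` (Mathlib's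
  `map_pi_eq_stdGaussian`: the standard Gaussian of `EuclideanSpace ℝ (Fin n)` is the image of
  `⨂ 𝒩(0,1)` under `toLp`, then `Measure.pi_map_pi`);
* `map_round_mul_gaussianReal_eq_gaussBoxMeasure` — at `σ = 2ᵇ/√2` the one-dimensional law is `ℓ_b`
  (`t/√2 ∼ 𝒩(0, ½)`);
* **`roundedGaussian_eq_indepLaw_gaussBoxPMF`** — `roundedGaussian n (2ᵇ/√2) = ⨂ⁿ ℓ_b` as `PMF`s;
* **`tvDist_indepLaw_lawPMF_roundedGaussian_le`** — the vector of `n` independent sampler outputs is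
  within statistical distance `n · ((F - 1) + 2e^{-(R - h/2)²})` of `roundedGaussian n (2ᵇ/√2)`
  (`tvDist_indepLaw_le`).

## References

* W. Feller, *An Introduction to Probability Theory and Its Applications II*, 2nd ed., Wiley 1971,
  III.4 (the multivariate normal: independent coordinates in an orthonormal frame) [folklore].
* O. Goldreich, *Foundations of Cryptography I*, CUP 2001, §3.2.3 (statistical distance of
  independent products, hybrid argument) [Goldreich2001].
-/

noncomputable section

namespace Literature.Probability.Distributions

open MeasureTheory ProbabilityTheory Real
open scoped NNReal ENNReal

variable (n : ℕ)

/-! ### The coordinates of the rounded Gaussian are independent -/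

/-- `round(σ g)` in canonical coordinates: the image of `⨂ 𝒩(0,1)` under `x ↦ (round(σ xᵢ))ᵢ`.
[folklore] -/
theorem roundedGaussianMeasure_eq_pi_map (σ : ℝ) :
    roundedGaussianMeasure n σ =
      (Measure.pi fun _ : Fin n => gaussianReal 0 1).map fun x i => round (σ * x i) := by
  unfold roundedGaussianMeasure
  rw [← map_pi_eq_stdGaussian (ι := Fin n),
    Measure.map_map (measurable_const_smul σ) (WithLp.measurable_toLp 2 (Fin n → ℝ)),
    Measure.map_map (measurable_roundVec n) ((measurable_const_smul σ).comp
      (WithLp.measurable_toLp 2 (Fin n → ℝ)))]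
  congr 1

/-- **The coordinates of `round(σ g)` are independent**, each with the law of `round(σ t)`,
`t ∼ 𝒩(0, 1)`. [folklore] -/
theorem roundedGaussianMeasure_eq_pi (σ : ℝ) :
    roundedGaussianMeasure n σ =
      Measure.pi fun _ : Fin n => (gaussianReal 0 1).map fun t : ℝ => round (σ * t) := by
  have hmeas : Measurable fun t : ℝ => round (σ * t) := by
    have h : (fun t : ℝ => round (σ * t)) = fun t => ⌊σ * t + 1 / 2⌋ := by
      funext t; exact round_eq _
    rw [h]
    exact Int.measurable_floor.comp ((measurable_const.mul measurable_id).add_const _)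
  rw [roundedGaussianMeasure_eq_pi_map]
  exact Measure.pi_map_pi fun _ => hmeas.aemeasurable

/-! ### At `σ = 2ᵇ/√2` the coordinate law is `ℓ_b` -/

/-- `𝒩(0, ½)` is `𝒩(0, 1)` scaled by `1/√2`. [folklore] -/
theorem gaussianReal_half_eq_map :
    gaussianReal 0 (1 / 2 : ℝ≥0) = (gaussianReal 0 1).map fun t : ℝ => (Real.sqrt 2)⁻¹ * t := by
  rw [gaussianReal_map_const_mul]
  congr 1
  · simp
  · ext
    push_cast
    rw [mul_one, inv_pow, Real.sq_sqrt (by norm_num)]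
    norm_num

/-- **The law of `round(2ᵇ t/√2)`, `t ∼ 𝒩(0,1)`, is `ℓ_b`** (`gaussBoxMeasure b`, the law of
`round(2ᵇ x)`, `x ∼ 𝒩(0, ½)`). [folklore] -/
theorem map_round_mul_gaussianReal_eq_gaussBoxMeasure (b : ℕ) :
    (gaussianReal 0 1).map (fun t : ℝ => round ((2 : ℝ) ^ b / Real.sqrt 2 * t)) = gaussBoxMeasure b := by
  have hmeas : Measurable fun t : ℝ => (Real.sqrt 2)⁻¹ * t := measurable_const.mul measurable_id
  rw [gaussBoxMeasure, gaussianReal_half_eq_map, Measure.map_map (measurable_round_two_pow_mul b) hmeas]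
  congr 1
  funext t
  simp only [Function.comp_apply]
  congr 1
  rw [div_eq_mul_inv]
  ring

/-- **`roundedGaussian n (2ᵇ/√2)` is the independent product of `n` copies of `ℓ_b`.** [folklore] -/
theorem roundedGaussian_eq_indepLaw_gaussBoxPMF (b : ℕ) :
    roundedGaussian n ((2 : ℝ) ^ b / Real.sqrt 2) = indepLaw n fun _ => gaussBoxPMF b := by
  apply PMF.toMeasure_injective
  rw [toMeasure_indepLaw, roundedGaussian, Measure.toPMF_toMeasure, roundedGaussianMeasure_eq_pi]
  congr 1
  funext i
  rw [map_round_mul_gaussianReal_eq_gaussBoxMeasure, gaussBoxPMF, Measure.toPMF_toMeasure]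

/-! ### The sampler vector is close to the rounded Gaussian -/

/-- **The vector of `n` independent pseudo-Gaussian samples is statistically close to the rounded
Gaussian `roundedGaussian n (2ᵇ/√2)`**: `Δ ≤ n · ((F - 1) + 2e^{-(R - h/2)²})` with the factor
`F = e^{hR + 2qR² + q}(1 + h)/(1 - p₀^J)` (`PGParams.tvDist_lawPMF_gaussBoxPMF_le`, `k ≥ 1`,
`p₀^J < 1`), by the hybrid argument for independent products (`tvDist_indepLaw_le`). [folklore] -/
theorem tvDist_indepLaw_lawPMF_roundedGaussian_le (P : PGParams) (hk : 1 ≤ P.k) (hJ : P.pNone ^ P.J < 1) :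
    (indepLaw n fun _ => P.lawPMF).tvDist (roundedGaussian n ((2 : ℝ) ^ P.b / Real.sqrt 2)) ≤
      n * ((exp (P.h * P.R + 2 * P.q * P.R ^ 2 + P.q) * (1 + P.h) / (1 - P.pNone ^ P.J) - 1) +
        2 * exp (-(P.R - P.h / 2) ^ 2)) := by
  rw [roundedGaussian_eq_indepLaw_gaussBoxPMF]
  refine (tvDist_indepLaw_le n _ _).trans ?_
  rw [Finset.sum_const, Finset.card_univ, Fintype.card_fin, nsmul_eq_mul]
  exact mul_le_mul_of_nonneg_left (P.tvDist_lawPMF_gaussBoxPMF_le hk hJ) (Nat.cast_nonneg n)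

end Literature.Probability.Distributions

end
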